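import Literature.MathematicalPhysics.QuantumLattice.VacuumConnectedCoeffBound
import Literature.MathematicalPhysics.QuantumLattice.HubbardTruncatedCoeffLimit
import HarnessLib

/-!
# The single-scale bound on the truncated two-point coefficients, uniformly in the volume

The two-point companion of `VacuumConnectedCoeffBound.lean`. For the truncated (linked-cluster)
coefficient of order `j` of the free-fermion perturbation series of the two-point function,

  `t_j = ∫_{Δ_j} (-β)^j Σ_{x⃗ ∈ Λ^j} 𝓔ᵀ(c†_{xσ}c_{yσ'}; n_{x₁↑}n_{x₁↓}(s₁); …; n_{x_j↑}n_{x_j↓}(s_j)) du`,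
  `s_i = -βu_i`

(the tree's `hubbardTruncatedCoeff = orderedIntegral j (truncatedIntegrand β h ox oy j) 1`, with
`twoPointUrsell`, `hubbardCluster`, `twoPointPropMatrix` of `HubbardLinkedCluster.lean`), assume an
even, translation invariant line bound `γ` on the entries of the chronological propagator matrices of
the two-point words in terms of the CLUSTER positions (sites identified with a finite abelian group
`Λ'` by `pos`; the external pair is one cluster, placed at the position `u` of its creation orbital,
the external orbitals being arbitrary functions `ox u`, `oy u` of that position). Then

  `Σ_{x⃗} |𝓔ᵀ_j(x⃗, s)| ≤ (j+1)^{j-1} · 2^{2j+1} · (8 Σ_z γ z)^j`      (`sum_norm_twoPointUrsell_le`),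
  `‖t_j‖ ≤ β^j/j! · (j+1)^{j-1} · 2^{2j+1} · (8 Σ_z γ z)^j`            (`norm_twoPointConnectedCoeff_le`):

NO volume factor (the cluster tree is anchored at the external pair) and GEOMETRIC in `j` up to
`(j+1)^{j-1}/j! ≤ e^{j+1}` — Benfatto–Giuliani–Mastropietro 2006, (2.77) summed over the vertex
positions at a single scale, with the determinant bound `δ = 2` of de Siqueira Pedra–Salmhofer 2008
(`PropMatrixTruncatedBound.propMatrix_weightedMinor_detBound`, uniform in `β`) fed into the positional
tree estimate `FermionicTree.sum_norm_ursellOf_moment_le_of_detBound`. As for the vacuum coefficients,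
the radius in `U` so obtained is `∝ (β Σ_z γ z)⁻¹`, polynomially small in the temperature: this is the
single-scale corner of hypothesis (A) of `HubbardTwoPointLimitReduction.bgm_two_point_limit_of_truncated_bounds`,
not BGM's multiscale window `β ≤ e^{c/|U|}`.

* `fieldsOf_hubbardCluster_none`, `fieldsOf_hubbardCluster_some`, `card_fieldsOf_hubbardCluster_le` —
  the external cluster carries one pair, every vertex two;
* `twoPointPropMatrix_eq_propMatrix_real`, `twoPoint_times_antitone_window` — at simplex times the
  two-point propagator matrix is a chronological `propMatrix` (real antitone times in `[-β, 0]`, the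
  external pair at time `0`);
* **`sum_norm_twoPointUrsell_le`**, **`norm_twoPointConnectedCoeff_le`** — the displayed bounds.

Everything is PROVED; no definition and no named fact.

## References

* G. Benfatto, A. Giuliani, V. Mastropietro, Ann. Henri Poincaré 7 (2006) 809–898, §2.2 (2.14)–(2.16)
  and (2.77). [cite: BenfattoGiulianiMastropietro2006, (2.77)]
* W. de Siqueira Pedra, M. Salmhofer, Comm. Math. Phys. 282 (2008) 797–818, Thm 2.4.
  [cite: PedraSalmhofer2008, Thm 2.4]
* D. C. Brydges, *A short course on cluster expansions*, Les Houches 1984, §2. [cite: Brydges1986, §2]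
-/

noncomputable section

open scoped Matrix.Norms.L2Operator ComplexOrder
open Finset MeasureTheory Set
open Literature.Probability.LatticeModels (ursellOf)
open Literature.Probability.LatticeModels.BattleFederbush

namespace Literature.MathematicalPhysics.QuantumLattice

/-! ### The two-point word: one pair in the external cluster, two per vertex -/

/-- The external cluster of the two-point word `c†_{xσ}c_{yσ'} ∏_i n_{x_i↑}(s_i)n_{x_i↓}(s_i)` carries
exactly the external pair (position `0`). [folklore] -/
theorem fieldsOf_hubbardCluster_none (j : ℕ) :
    FermionicTree.fieldsOf (hubbardCluster j) {none} = {0} := by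
  ext a
  simp only [FermionicTree.mem_fieldsOf, Finset.mem_singleton]
  induction a using Fin.cases with
  | zero => simp
  | succ m => simp [hubbardCluster_succ, Fin.succ_ne_zero]

/-- The cluster of vertex `i` carries its two pairs `1 + 2i`, `1 + 2i + 1`. [folklore] -/
theorem fieldsOf_hubbardCluster_some (j : ℕ) (i : Fin j) :
    FermionicTree.fieldsOf (hubbardCluster j) {some i} =
      (univ : Finset (Fin 2)).image fun r => (finProdFinEquiv (i, r)).succ := by
  ext a
  simp only [FermionicTree.mem_fieldsOf, Finset.mem_singleton, Finset.mem_image, Finset.mem_univ,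
    true_and]
  induction a using Fin.cases with
  | zero => simp [Fin.succ_ne_zero]
  | succ m =>
      rw [hubbardCluster_succ, Option.some_inj]
      constructor
      · intro hm
        refine ⟨(finProdFinEquiv.symm m).2, ?_⟩
        rw [Fin.succ_inj]
        apply finProdFinEquiv.symm.injective
        rw [Equiv.symm_apply_apply]
        exact Prod.ext hm.symm rfl
      · rintro ⟨r, hr⟩
        rw [Fin.succ_inj] at hr
        rw [← hr]
        simp

/-- Every cluster of the two-point word carries at most two pairs. [folklore] -/
theorem card_fieldsOf_hubbardCluster_le (j : ℕ) (x : Option (Fin j)) :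
    (FermionicTree.fieldsOf (hubbardCluster j) {x}).card ≤ 2 := by
  cases x with
  | none => rw [fieldsOf_hubbardCluster_none, Finset.card_singleton]; norm_num
  | some i =>
      rw [fieldsOf_hubbardCluster_some]
      exact Finset.card_image_le.trans (by simp)

/-! ### Chronological times of the two-point word -/

variable {Λ : Type*} [LinearOrder Λ] [Fintype Λ] (β : ℝ) (h : Matrix (Orb Λ) (Orb Λ) ℂ)

/-- **The two-point propagator matrix at simplex times is a chronological `propMatrix`**: its pair
times are the real word times (`0` for the external pair, `-β v_i` for the pairs of vertex `i`).
[folklore] -/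
theorem twoPointPropMatrix_eq_propMatrix_real (ox oy : Orb Λ) {j : ℕ} (g : Fin j → Λ) (v : Fin j → ℝ) :
    twoPointPropMatrix β h ox oy g (fun i => ((v i : ℝ) : ℂ) * -(β : ℂ)) =
      propMatrix β h (hubbardWordOrb ox g) (hubbardWordOrb oy g)
        (fun a => ((hubbardWordTimeR (fun i => v i * -β) a : ℝ) : ℂ)) := by
  unfold twoPointPropMatrix
  congr 1
  funext a
  rw [← hubbardWordTime_ofReal]
  congr 1
  funext i
  push_cast
  ring

/-- The real word times of a monotone `v` with values in `[0, 1]` are antitone in the pair index and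
lie in the window `[-β, 0]` (for `0 ≤ β`): the external pair at time `0` comes first. [folklore] -/
theorem twoPoint_times_antitone_window {j : ℕ} {β : ℝ} (hβ : 0 ≤ β) {v : Fin j → ℝ} (hv : Monotone v)
    (hv01 : ∀ i, v i ∈ Icc (0 : ℝ) 1) :
    Antitone (hubbardWordTimeR (fun i => v i * -β)) ∧
      ∀ a : Fin (j * 2 + 1), -β ≤ hubbardWordTimeR (fun i => v i * -β) a ∧
        hubbardWordTimeR (fun i => v i * -β) a ≤ -β + β := by
  obtain ⟨hanti, hwin⟩ := vacuum_times_antitone_window (j := j) hβ hv hv01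
  have hle0 : ∀ m : Fin (j * 2), v (finProdFinEquiv.symm m).1 * -β ≤ 0 := fun m => by
    have := (hwin m).2; linarith
  refine ⟨fun a b hab => ?_, fun a => ?_⟩
  · induction b using Fin.cases with
    | zero =>
        have ha : a = 0 := Fin.le_zero_iff.mp hab
        subst ha
        exact le_rfl
    | succ m' =>
        induction a using Fin.cases with
        | zero =>
            rw [hubbardWordTimeR_zero, hubbardWordTimeR_succ]
            exact hle0 m'
        | succ m =>
            rw [hubbardWordTimeR_succ, hubbardWordTimeR_succ]
            exact hanti (Fin.succ_le_succ_iff.mp hab)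
  · induction a using Fin.cases with
    | zero => rw [hubbardWordTimeR_zero]; constructor <;> linarith
    | succ m => rw [hubbardWordTimeR_succ]; exact hwin m

/-! ### The positional sum of the two-point Ursell functions -/

variable {Λ' : Type*} [AddCommGroup Λ'] [Fintype Λ'] [DecidableEq Λ']

/-- **The positional sum of the truncated expectations of the two-point word, uniformly in `β` and in
the volume**: for Hermitian `h`, `0 ≤ β`, monotone simplex times `v ∈ [0,1]^j`, sites identified with a
finite abelian group `Λ'` by `pos`, external orbitals `ox u`, `oy u` attached to the position `u` of the
external cluster, and an even translation invariant line bound `γ` on the entries of the two-point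
propagator matrices in terms of the cluster positions (`u` for the external pair, `pos x_i` for vertex
`i`), for every `a ∈ Λ'`,
`Σ_{x⃗ ∈ Λ^j} |𝓔ᵀ(c†c (a); x⃗, -βv)| ≤ (j+1)^{j-1} · 2^{2j+1} · (8 Σ_z γ z)^j`
(determinant bound `2`, at most two pairs per cluster, tree decay anchored at the external pair — no
volume factor). [cite: BenfattoGiulianiMastropietro2006, (2.77)] -/
theorem sum_norm_twoPointUrsell_le (hh : h.IsHermitian) (hβ : 0 ≤ β) (pos : Λ ≃ Λ')
    (ox oy : Λ' → Orb Λ) (γ : Λ' → ℝ) (hγ0 : ∀ z, 0 ≤ γ z) (hγ : ∀ z, γ (-z) = γ z)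
    {j : ℕ} (v : Fin j → ℝ) (hvm : Monotone v) (hv01 : ∀ i, v i ∈ Icc (0 : ℝ) 1)
    (hG : ∀ (u : Λ') (g : Fin j → Λ) (f f' : Fin (j * 2 + 1)),
      ‖twoPointPropMatrix β h (ox u) (oy u) g (fun i => ((v i : ℝ) : ℂ) * -(β : ℂ)) f f'‖ ≤
        γ ((hubbardCluster j f).elim u (fun k => pos (g k)) -
          (hubbardCluster j f').elim u (fun k => pos (g k))))
    (a : Λ') :
    ∑ g : Fin j → Λ, ‖twoPointUrsell β h (ox a) (oy a) g (fun i => ((v i : ℝ) : ℂ) * -(β : ℂ))‖ ≤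
      ((j + 1 : ℕ) : ℝ) ^ (j - 1) * ((2 : ℝ) ^ (j * 2 + 1) * (8 * ∑ z, γ z) ^ j) := by
  classical
  -- the family of propagator matrices indexed by all cluster positions
  set Gp : (Option (Fin j) → Λ') → Matrix (Fin (j * 2 + 1)) (Fin (j * 2 + 1)) ℂ := fun p =>
    twoPointPropMatrix β h (ox (p none)) (oy (p none)) (fun k => pos.symm (p (some k)))
      (fun i => ((v i : ℝ) : ℂ) * -(β : ℂ)) with hGp
  have key := FermionicTree.sum_norm_ursellOf_moment_le_of_detBound (𝕜 := ℂ) (hubbardCluster j) Gp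
    (δ := 2) (by norm_num) (fun p => ?_) γ hγ0 hγ (fun p f f' => ?_) 2
    (card_fieldsOf_hubbardCluster_le j) a (v := none)
  · -- reindex the positional sum by the cluster positions pinned at the external pair
    have hre : ∑ g : Fin j → Λ,
          ‖twoPointUrsell β h (ox a) (oy a) g (fun i => ((v i : ℝ) : ℂ) * -(β : ℂ))‖ =
        ∑ p ∈ univ.filter (fun p : Option (Fin j) → Λ' => p none = a),
          ‖ursellOf (FermionicTree.moment (hubbardCluster j) (Gp p)) univ‖ := by
      refine Finset.sum_nbij' (fun g o => o.elim a (fun k => pos (g k)))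
        (fun p k => pos.symm (p (some k))) ?_ ?_ ?_ ?_ ?_
      · intro g _
        simp
      · intro p _
        exact mem_univ _
      · intro g _
        funext k
        simp
      · intro p hp
        rw [Finset.mem_filter] at hp
        funext o
        cases o with
        | none => simpa using hp.2.symm
        | some k => simp
      · intro g _
        simp only [hGp, twoPointUrsell, Option.elim_none, Option.elim_some, Equiv.symm_apply_apply]
    rw [hre]
    refine key.trans (le_of_eq ?_)
    rw [Fintype.card_option, Fintype.card_fin, Fintype.card_fin]
    have h1 : j + 1 - 2 = j - 1 := by omega
    rw [h1, Nat.add_sub_cancel]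
    norm_num
  · -- the determinant bound `2`, from the chronological structure
    obtain ⟨hanti, hwin⟩ := twoPoint_times_antitone_window (j := j) hβ hvm hv01
    simp only [hGp]
    rw [twoPointPropMatrix_eq_propMatrix_real]
    exact propMatrix_weightedMinor_detBound hh β (-β) _ _ _ hanti hwin
  · -- the line bound
    have hp : ∀ o : Option (Fin j),
        o.elim (p none) (fun k => pos (pos.symm (p (some k)))) = p o := by
      intro o
      cases o <;> simp
    have := hG (p none) (fun k => pos.symm (p (some k))) f f'
    rw [hp, hp] at this
    exact this

/-! ### The bound on the truncated coefficient -/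

/-- **The single-scale bound on the truncated two-point coefficient, with no volume factor**: under
the hypotheses of `sum_norm_twoPointUrsell_le` (for all monotone simplex times),
`‖t_j‖ ≤ β^j/j! · (j+1)^{j-1} · 2^{2j+1} · (8 Σ_z γ z)^j` with
`t_j = ∫_{Δ_j} (-β)^j Σ_{x⃗} 𝓔ᵀ(c†c (a); x⃗, -βu) du = orderedIntegral j (truncatedIntegrand β h (ox a) (oy a) j) 1`.
With `(j+1)^{j-1}/j! ≤ e^{j+1}` this is `(C β Σ_z γ z)^j`-type: the truncated series `Σ_j U^j t_j`
converges for `|U| ≲ (β Σ_z γ z)⁻¹`, uniformly in the volume — Benfatto–Giuliani–Mastropietro 2006,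
(2.77) at a single scale. [cite: BenfattoGiulianiMastropietro2006, (2.77)] -/
theorem norm_twoPointConnectedCoeff_le (hh : h.IsHermitian) (hβ : 0 ≤ β) (pos : Λ ≃ Λ')
    (ox oy : Λ' → Orb Λ) (γ : Λ' → ℝ) (hγ0 : ∀ z, 0 ≤ γ z) (hγ : ∀ z, γ (-z) = γ z) {j : ℕ}
    (hG : ∀ (v : Fin j → ℝ), Monotone v → (∀ i, v i ∈ Icc (0 : ℝ) 1) →
      ∀ (u : Λ') (g : Fin j → Λ) (f f' : Fin (j * 2 + 1)),
        ‖twoPointPropMatrix β h (ox u) (oy u) g (fun i => ((v i : ℝ) : ℂ) * -(β : ℂ)) f f'‖ ≤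
          γ ((hubbardCluster j f).elim u (fun k => pos (g k)) -
            (hubbardCluster j f').elim u (fun k => pos (g k))))
    (a : Λ') :
    ‖orderedIntegral j (truncatedIntegrand β h (ox a) (oy a) j) 1‖ ≤
      β ^ j / j.factorial *
        (((j + 1 : ℕ) : ℝ) ^ (j - 1) * ((2 : ℝ) ^ (j * 2 + 1) * (8 * ∑ z, γ z) ^ j)) := by
  classical
  set K : ℝ := ((j + 1 : ℕ) : ℝ) ^ (j - 1) * ((2 : ℝ) ^ (j * 2 + 1) * (8 * ∑ z, γ z) ^ j) with hK
  have hγ1 : 0 ≤ ∑ z, γ z := sum_nonneg fun z _ => hγ0 z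
  have hK0 : 0 ≤ K := by positivity
  -- pointwise bound on the simplex
  have hpt : ∀ v : Fin j → ℝ, Monotone v → (∀ i, v i ∈ Icc (0 : ℝ) 1) →
      ‖truncatedIntegrand β h (ox a) (oy a) j v‖ ≤ β ^ j * K := by
    intro v hvm hv01
    show ‖(-(β : ℂ)) ^ j * ∑ g : Fin j → Λ,
        twoPointUrsell β h (ox a) (oy a) g (fun i => ((v i : ℝ) : ℂ) * -(β : ℂ))‖ ≤ β ^ j * K
    rw [norm_mul, norm_pow, norm_neg, Complex.norm_real, Real.norm_of_nonneg hβ]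
    refine mul_le_mul_of_nonneg_left ?_ (pow_nonneg hβ _)
    exact (norm_sum_le _ _).trans
      (sum_norm_twoPointUrsell_le β h hh hβ pos ox oy γ hγ0 hγ v hvm hv01 (hG v hvm hv01) a)
  calc _ ≤ β ^ j * K * 1 ^ j / j.factorial :=
        norm_orderedIntegral_le_of_monotone j _ zero_le_one (by positivity) hpt
    _ = β ^ j / j.factorial * K := by rw [one_pow]; ring

end Literature.MathematicalPhysics.QuantumLattice
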